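import Summits.CriticalPhenomena.PercolationContinuityZ3.Theorems.PercNearOneGluingNoHeavyLowerTailThreePartitionVOrderPrincipal

/-!
# Conjecture W on CYLINDERS: the refined certificate property `R` and its stability under a free coordinate (THEOREM F)

Support file (lineage `prim-bnk-2`, generation 34; `--supports stmt-CriticalPhenomena-4575`; memo
`run/shared/lean/prim/prim-l12/FROM-prim-bnk-2-g34-CONJ-R.md` §2).  No `sorry`, no new definitions, standard axioms.

For a family `A` of subsets of a finite ground set `V` (in the application an up-set; the cylinder `{(a,b) : a ∈ A}` of
Conjecture V / W, files `…ThreePartitionVOrder`, `…ThreePartitionVOrderKernel`) the weighted `E₃` face kernel summed over the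
faces `(a | b | c)` of the cube `2^V` with `a ∈ A` splits as `D + N`,
  `D_A(Z) = Σ_{a ∈ A} Σ_{b ⊆ V∖a} (2 Z(a,a) − Z(c,c))`,   `N_A(Z) = Σ_{a ∈ A} Σ_{b ⊆ V∖a} (Z(c,b) − Z(c,a) − Z(a,c))`   (`c = V∖a∖b`).
**Property `R(V, A, Q)`** (memo §2, this work): `Q : 2^V × 2^V → ℤ≥0` is a *certificate* if for every weight `Z` that is monotone in
each argument and 2-increasing, `D_A(Z) ≥ ⟨Q, Z⟩` and `N_A(Z) + ⟨Q, Z⟩ ≥ 0` (`⟨Q,Z⟩ = Σ_{S,T ⊆ V} Q(S,T) Z(S,T)`).  By LP duality this says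
that the coefficient matrices of `D_A − Q` and `N_A + Q` both lie in the cone `USN ⊗ USN`; CONJECTURE R (memo; census: all up-sets
on `|V| ≤ 5`) asserts that every up-set has a certificate.  `R` trivially gives Conjecture W on the cylinder
(`cylinder_kernelZ_sum_nonneg_of_certificate`).  **THEOREM F** (`cylinder_certificate_insert`): if `Q` is a certificate for `A`
on `V` and `e ∉ V`, then the lift `Q⁺ = Q ⊗ diag(2,1)` (`Q⁺(S,T) = 2Q(S,T)`, `Q⁺(S+e,T+e) = Q(S,T)`, `0` on mixed pairs) is a
certificate for the free extension `A⁺ = {a ⊆ V+e : a∖e ∈ A}` on `V + e`: the slice identities `D_{A⁺} = D_A ⊗ diag(2,1)`,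
`N_{A⁺} = N_A ⊗ W` (`W = E₀₀+E₀₁+E₁₀`) reduce the two inequalities to the hypotheses at the restricted weights `Z(·+e, ·+e)`, `Z`,
`Z + Z(·, ·+e) + Z(·+e, ·)` plus `Q ≥ 0` times the second difference of `Z` in `e`.  Hence a certificate for `A` yields Conjecture W
(so Conjecture V for all `𝒱, 𝒲`) on `A × (free cube)` of any dimension; base case `cylinder_certificate_empty`. [this work]
-/

namespace Summit.CriticalPhenomena.PercolationContinuityZ3.Theorems.ThreePartition

open Finset

variable {ι : Type*} [DecidableEq ι]

/-- Pairing of the lifted certificate `Q ⊗ diag(2,1)` with a weight on `2^(V+e)`: `⟨Q⁺, Z⟩ = Σ_{S,T ⊆ V} (2Q(S,T)Z(S,T) + Q(S,T)Z(S+e,T+e))`.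
[this work] -/
theorem sum_liftCertificate_mul {e : ι} {V : Finset ι} (he : e ∉ V) (Q Z : Finset ι → Finset ι → ℤ) :
    ∑ S ∈ (insert e V).powerset, ∑ T ∈ (insert e V).powerset,
        (if e ∈ S then (if e ∈ T then Q (S.erase e) (T.erase e) else 0) else (if e ∈ T then 0 else 2 * Q S T)) * Z S T =
      ∑ S ∈ V.powerset, ∑ T ∈ V.powerset, (2 * Q S T * Z S T + Q S T * Z (insert e S) (insert e T)) := by
  rw [Finset.sum_powerset_insert he]
  have h1 : ∀ S ∈ V.powerset, (∑ T ∈ (insert e V).powerset,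
      (if e ∈ S then (if e ∈ T then Q (S.erase e) (T.erase e) else 0) else (if e ∈ T then 0 else 2 * Q S T)) * Z S T) =
      ∑ T ∈ V.powerset, 2 * Q S T * Z S T := by
    intro S hS
    have heS : e ∉ S := fun h => he (Finset.mem_powerset.1 hS h)
    rw [Finset.sum_powerset_insert he]
    have hz : ∑ T ∈ V.powerset,
        (if e ∈ S then (if e ∈ insert e T then Q (S.erase e) ((insert e T).erase e) else 0)
          else (if e ∈ insert e T then 0 else 2 * Q S (insert e T))) * Z S (insert e T) = 0 := by
      refine Finset.sum_eq_zero fun T _ => ?_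
      rw [if_neg heS, if_pos (Finset.mem_insert_self e T), zero_mul]
    rw [hz, add_zero]
    refine Finset.sum_congr rfl fun T hT => ?_
    have heT : e ∉ T := fun h => he (Finset.mem_powerset.1 hT h)
    rw [if_neg heS, if_neg heT]
  have h2 : ∀ S ∈ V.powerset, (∑ T ∈ (insert e V).powerset,
      (if e ∈ insert e S then (if e ∈ T then Q ((insert e S).erase e) (T.erase e) else 0)
        else (if e ∈ T then 0 else 2 * Q (insert e S) T)) * Z (insert e S) T) =
      ∑ T ∈ V.powerset, Q S T * Z (insert e S) (insert e T) := by
    intro S hS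
    have heS : e ∉ S := fun h => he (Finset.mem_powerset.1 hS h)
    rw [Finset.sum_powerset_insert he]
    have hz : ∑ T ∈ V.powerset,
        (if e ∈ insert e S then (if e ∈ T then Q ((insert e S).erase e) (T.erase e) else 0)
          else (if e ∈ T then 0 else 2 * Q (insert e S) T)) * Z (insert e S) T = 0 := by
      refine Finset.sum_eq_zero fun T hT => ?_
      have heT : e ∉ T := fun h => he (Finset.mem_powerset.1 hT h)
      rw [if_pos (Finset.mem_insert_self e S), if_neg heT, zero_mul]
    rw [hz, zero_add]
    refine Finset.sum_congr rfl fun T hT => ?_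
    have heT : e ∉ T := fun h => he (Finset.mem_powerset.1 hT h)
    rw [if_pos (Finset.mem_insert_self e S), if_pos (Finset.mem_insert_self e T), Finset.erase_insert heS,
      Finset.erase_insert heT]
  rw [Finset.sum_congr rfl h1, Finset.sum_congr rfl h2, ← Finset.sum_add_distrib]
  refine Finset.sum_congr rfl fun S _ => ?_
  rw [← Finset.sum_add_distrib]

/-- **THEOREM F (free-coordinate stability of certificates).**  Let `Q ≥ 0` be a certificate for the family `P` on `V`:
`D_P(Z) ≥ ⟨Q,Z⟩` and `N_P(Z) + ⟨Q,Z⟩ ≥ 0` for every weight `Z` that is monotone in each argument and 2-increasing.  Then for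
`e ∉ V` the lift `Q ⊗ diag(2,1)` is a certificate for the free extension `a ↦ P (a.erase e)` on `insert e V`. [this work] -/
theorem cylinder_certificate_insert {e : ι} {V : Finset ι} (he : e ∉ V) (P : Finset ι → Prop) [DecidablePred P]
    (Q : Finset ι → Finset ι → ℤ) (hQ : ∀ S T, 0 ≤ Q S T)
    (hD : ∀ Z : Finset ι → Finset ι → ℤ, (∀ S S' T, S ⊆ S' → Z S T ≤ Z S' T) → (∀ S T T', T ⊆ T' → Z S T ≤ Z S T') →
      (∀ S S' T T', S ⊆ S' → T ⊆ T' → Z S' T + Z S T' ≤ Z S' T' + Z S T) →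
      ∑ S ∈ V.powerset, ∑ T ∈ V.powerset, Q S T * Z S T ≤
        ∑ a ∈ V.powerset, ∑ b ∈ (V \ a).powerset,
          (if P a then 2 * Z a a - Z ((V \ a) \ b) ((V \ a) \ b) else 0))
    (hN : ∀ Z : Finset ι → Finset ι → ℤ, (∀ S S' T, S ⊆ S' → Z S T ≤ Z S' T) → (∀ S T T', T ⊆ T' → Z S T ≤ Z S T') →
      (∀ S S' T T', S ⊆ S' → T ⊆ T' → Z S' T + Z S T' ≤ Z S' T' + Z S T) →
      0 ≤ (∑ a ∈ V.powerset, ∑ b ∈ (V \ a).powerset,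
          (if P a then Z ((V \ a) \ b) b - Z ((V \ a) \ b) a - Z a ((V \ a) \ b) else 0)) +
        ∑ S ∈ V.powerset, ∑ T ∈ V.powerset, Q S T * Z S T) :
    (∀ Z : Finset ι → Finset ι → ℤ, (∀ S S' T, S ⊆ S' → Z S T ≤ Z S' T) → (∀ S T T', T ⊆ T' → Z S T ≤ Z S T') →
      (∀ S S' T T', S ⊆ S' → T ⊆ T' → Z S' T + Z S T' ≤ Z S' T' + Z S T) →
      ∑ S ∈ (insert e V).powerset, ∑ T ∈ (insert e V).powerset,
          (if e ∈ S then (if e ∈ T then Q (S.erase e) (T.erase e) else 0) else (if e ∈ T then 0 else 2 * Q S T)) * Z S T ≤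
        ∑ a ∈ (insert e V).powerset, ∑ b ∈ (insert e V \ a).powerset,
          (if P (a.erase e) then 2 * Z a a - Z ((insert e V \ a) \ b) ((insert e V \ a) \ b) else 0)) ∧
    (∀ Z : Finset ι → Finset ι → ℤ, (∀ S S' T, S ⊆ S' → Z S T ≤ Z S' T) → (∀ S T T', T ⊆ T' → Z S T ≤ Z S T') →
      (∀ S S' T T', S ⊆ S' → T ⊆ T' → Z S' T + Z S T' ≤ Z S' T' + Z S T) →
      0 ≤ (∑ a ∈ (insert e V).powerset, ∑ b ∈ (insert e V \ a).powerset,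
          (if P (a.erase e) then Z ((insert e V \ a) \ b) b - Z ((insert e V \ a) \ b) a - Z a ((insert e V \ a) \ b) else 0)) +
        ∑ S ∈ (insert e V).powerset, ∑ T ∈ (insert e V).powerset,
          (if e ∈ S then (if e ∈ T then Q (S.erase e) (T.erase e) else 0) else (if e ∈ T then 0 else 2 * Q S T)) * Z S T) := by
  constructor
  · intro Z hl hr hm
    rw [sum_liftCertificate_mul he,
      sum_threePartitions_insert he (fun a b c => if P (a.erase e) then 2 * Z a a - Z c c else 0)]
    -- restricted weight `Z₁₁(S,T) = Z(S+e, T+e)`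
    have hl1 : ∀ S S' T : Finset ι, S ⊆ S' → Z (insert e S) (insert e T) ≤ Z (insert e S') (insert e T) :=
      fun S S' T hST => hl _ _ _ (Finset.insert_subset_insert e hST)
    have hr1 : ∀ S T T' : Finset ι, T ⊆ T' → Z (insert e S) (insert e T) ≤ Z (insert e S) (insert e T') :=
      fun S T T' hT => hr _ _ _ (Finset.insert_subset_insert e hT)
    have hm1 : ∀ S S' T T' : Finset ι, S ⊆ S' → T ⊆ T' →
        Z (insert e S') (insert e T) + Z (insert e S) (insert e T') ≤ Z (insert e S') (insert e T') + Z (insert e S) (insert e T) :=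
      fun S S' T T' hS hT => hm _ _ _ _ (Finset.insert_subset_insert e hS) (Finset.insert_subset_insert e hT)
    have k1 := hD (fun S T => Z (insert e S) (insert e T)) hl1 hr1 hm1
    have k0 := hD Z hl hr hm
    have hsplit : ∑ a ∈ V.powerset, ∑ b ∈ (V \ a).powerset,
        ((if P ((insert e a).erase e) then 2 * Z (insert e a) (insert e a) - Z ((V \ a) \ b) ((V \ a) \ b) else 0) +
          (if P (a.erase e) then 2 * Z a a - Z ((V \ a) \ b) ((V \ a) \ b) else 0) +
          (if P (a.erase e) then 2 * Z a a - Z (insert e ((V \ a) \ b)) (insert e ((V \ a) \ b)) else 0)) =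
        (∑ a ∈ V.powerset, ∑ b ∈ (V \ a).powerset,
          (if P a then 2 * Z (insert e a) (insert e a) - Z (insert e ((V \ a) \ b)) (insert e ((V \ a) \ b)) else 0)) +
        2 * ∑ a ∈ V.powerset, ∑ b ∈ (V \ a).powerset,
          (if P a then 2 * Z a a - Z ((V \ a) \ b) ((V \ a) \ b) else 0) := by
      rw [Finset.mul_sum, ← Finset.sum_add_distrib]
      refine Finset.sum_congr rfl fun a ha => ?_
      have hea : e ∉ a := fun h => he (Finset.mem_powerset.1 ha h)
      rw [Finset.mul_sum, ← Finset.sum_add_distrib]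
      refine Finset.sum_congr rfl fun b _ => ?_
      rw [Finset.erase_insert hea, Finset.erase_eq_of_notMem hea]
      split_ifs <;> ring
    rw [hsplit]
    have hpair : ∑ S ∈ V.powerset, ∑ T ∈ V.powerset, (2 * Q S T * Z S T + Q S T * Z (insert e S) (insert e T)) =
        2 * (∑ S ∈ V.powerset, ∑ T ∈ V.powerset, Q S T * Z S T) +
          ∑ S ∈ V.powerset, ∑ T ∈ V.powerset, Q S T * Z (insert e S) (insert e T) := by
      rw [Finset.mul_sum, ← Finset.sum_add_distrib]
      refine Finset.sum_congr rfl fun S _ => ?_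
      rw [Finset.mul_sum, ← Finset.sum_add_distrib]
      refine Finset.sum_congr rfl fun T _ => ?_
      ring
    rw [hpair]
    linarith [k0, k1]
  · intro Z hl hr hm
    rw [sum_liftCertificate_mul he,
      sum_threePartitions_insert he (fun a b c => if P (a.erase e) then Z c b - Z c a - Z a c else 0)]
    -- the weight `Y = Z + Z(·, ·+e) + Z(·+e, ·)` is admissible
    have hlY : ∀ S S' T : Finset ι, S ⊆ S' →
        Z S T + Z S (insert e T) + Z (insert e S) T ≤ Z S' T + Z S' (insert e T) + Z (insert e S') T := by
      intro S S' T hST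
      have := hl S S' T hST
      have := hl S S' (insert e T) hST
      have := hl (insert e S) (insert e S') T (Finset.insert_subset_insert e hST)
      linarith
    have hrY : ∀ S T T' : Finset ι, T ⊆ T' →
        Z S T + Z S (insert e T) + Z (insert e S) T ≤ Z S T' + Z S (insert e T') + Z (insert e S) T' := by
      intro S T T' hT
      have := hr S T T' hT
      have := hr S (insert e T) (insert e T') (Finset.insert_subset_insert e hT)
      have := hr (insert e S) T T' hT
      linarith
    have hmY : ∀ S S' T T' : Finset ι, S ⊆ S' → T ⊆ T' →
        (Z S' T + Z S' (insert e T) + Z (insert e S') T) + (Z S T' + Z S (insert e T') + Z (insert e S) T') ≤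
          (Z S' T' + Z S' (insert e T') + Z (insert e S') T') + (Z S T + Z S (insert e T) + Z (insert e S) T) := by
      intro S S' T T' hS hT
      have := hm S S' T T' hS hT
      have := hm S S' (insert e T) (insert e T') hS (Finset.insert_subset_insert e hT)
      have := hm (insert e S) (insert e S') T T' (Finset.insert_subset_insert e hS) hT
      linarith
    have kY := hN (fun S T => Z S T + Z S (insert e T) + Z (insert e S) T) hlY hrY hmY
    have hsplit : ∑ a ∈ V.powerset, ∑ b ∈ (V \ a).powerset,
        ((if P ((insert e a).erase e) then
            Z ((V \ a) \ b) b - Z ((V \ a) \ b) (insert e a) - Z (insert e a) ((V \ a) \ b) else 0) +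
          (if P (a.erase e) then
            Z ((V \ a) \ b) (insert e b) - Z ((V \ a) \ b) a - Z a ((V \ a) \ b) else 0) +
          (if P (a.erase e) then
            Z (insert e ((V \ a) \ b)) b - Z (insert e ((V \ a) \ b)) a - Z a (insert e ((V \ a) \ b)) else 0)) =
        ∑ a ∈ V.powerset, ∑ b ∈ (V \ a).powerset,
          (if P a then
            (Z ((V \ a) \ b) b + Z ((V \ a) \ b) (insert e b) + Z (insert e ((V \ a) \ b)) b) -
              (Z ((V \ a) \ b) a + Z ((V \ a) \ b) (insert e a) + Z (insert e ((V \ a) \ b)) a) -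
              (Z a ((V \ a) \ b) + Z a (insert e ((V \ a) \ b)) + Z (insert e a) ((V \ a) \ b)) else 0) := by
      refine Finset.sum_congr rfl fun a ha => ?_
      have hea : e ∉ a := fun h => he (Finset.mem_powerset.1 ha h)
      refine Finset.sum_congr rfl fun b _ => ?_
      rw [Finset.erase_insert hea, Finset.erase_eq_of_notMem hea]
      split_ifs <;> ring
    rw [hsplit]
    -- the square term `Q(S,T) · (Z(S,T) + Z(S+e,T+e) − Z(S,T+e) − Z(S+e,T)) ≥ 0`
    have hsq : 0 ≤ ∑ S ∈ V.powerset, ∑ T ∈ V.powerset,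
        Q S T * (Z S T + Z (insert e S) (insert e T) - Z S (insert e T) - Z (insert e S) T) := by
      refine Finset.sum_nonneg fun S _ => Finset.sum_nonneg fun T _ => mul_nonneg (hQ S T) ?_
      have := hm S (insert e S) T (insert e T) (Finset.subset_insert e S) (Finset.subset_insert e T)
      linarith
    have hpair : ∑ S ∈ V.powerset, ∑ T ∈ V.powerset, (2 * Q S T * Z S T + Q S T * Z (insert e S) (insert e T)) =
        (∑ S ∈ V.powerset, ∑ T ∈ V.powerset, Q S T * (Z S T + Z S (insert e T) + Z (insert e S) T)) +
          ∑ S ∈ V.powerset, ∑ T ∈ V.powerset,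
            Q S T * (Z S T + Z (insert e S) (insert e T) - Z S (insert e T) - Z (insert e S) T) := by
      rw [← Finset.sum_add_distrib]
      refine Finset.sum_congr rfl fun S _ => ?_
      rw [← Finset.sum_add_distrib]
      refine Finset.sum_congr rfl fun T _ => ?_
      ring
    rw [hpair]
    linarith [kY, hsq]

/-- **A certificate gives Conjecture W on the cylinder.**  If `Q` is a certificate for `P` on `V` then the weighted `E₃` face kernel
summed over the faces `(a | b | c)` of `2^V` with `P a` is `≥ 0` for every monotone 2-increasing weight `Z`
(= the cylinder case, τ = ∅, of `VOrderKernelPositivity` in powerset form). [this work] -/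
theorem cylinder_kernelZ_sum_nonneg_of_certificate (V : Finset ι) (P : Finset ι → Prop) [DecidablePred P]
    (Q : Finset ι → Finset ι → ℤ)
    (hD : ∀ Z : Finset ι → Finset ι → ℤ, (∀ S S' T, S ⊆ S' → Z S T ≤ Z S' T) → (∀ S T T', T ⊆ T' → Z S T ≤ Z S T') →
      (∀ S S' T T', S ⊆ S' → T ⊆ T' → Z S' T + Z S T' ≤ Z S' T' + Z S T) →
      ∑ S ∈ V.powerset, ∑ T ∈ V.powerset, Q S T * Z S T ≤
        ∑ a ∈ V.powerset, ∑ b ∈ (V \ a).powerset,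
          (if P a then 2 * Z a a - Z ((V \ a) \ b) ((V \ a) \ b) else 0))
    (hN : ∀ Z : Finset ι → Finset ι → ℤ, (∀ S S' T, S ⊆ S' → Z S T ≤ Z S' T) → (∀ S T T', T ⊆ T' → Z S T ≤ Z S T') →
      (∀ S S' T T', S ⊆ S' → T ⊆ T' → Z S' T + Z S T' ≤ Z S' T' + Z S T) →
      0 ≤ (∑ a ∈ V.powerset, ∑ b ∈ (V \ a).powerset,
          (if P a then Z ((V \ a) \ b) b - Z ((V \ a) \ b) a - Z a ((V \ a) \ b) else 0)) +
        ∑ S ∈ V.powerset, ∑ T ∈ V.powerset, Q S T * Z S T)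
    (Z : Finset ι → Finset ι → ℤ) (hl : ∀ S S' T, S ⊆ S' → Z S T ≤ Z S' T) (hr : ∀ S T T', T ⊆ T' → Z S T ≤ Z S T')
    (hm : ∀ S S' T T', S ⊆ S' → T ⊆ T' → Z S' T + Z S T' ≤ Z S' T' + Z S T) :
    0 ≤ ∑ a ∈ V.powerset, ∑ b ∈ (V \ a).powerset,
      (if P a then 2 * Z a a + Z ((V \ a) \ b) b - Z ((V \ a) \ b) a - Z a ((V \ a) \ b) - Z ((V \ a) \ b) ((V \ a) \ b)
        else 0) := by
  have k1 := hD Z hl hr hm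
  have k2 := hN Z hl hr hm
  have hsplit : ∑ a ∈ V.powerset, ∑ b ∈ (V \ a).powerset,
      (if P a then 2 * Z a a + Z ((V \ a) \ b) b - Z ((V \ a) \ b) a - Z a ((V \ a) \ b) - Z ((V \ a) \ b) ((V \ a) \ b)
        else 0) =
      (∑ a ∈ V.powerset, ∑ b ∈ (V \ a).powerset,
          (if P a then 2 * Z a a - Z ((V \ a) \ b) ((V \ a) \ b) else 0)) +
      ∑ a ∈ V.powerset, ∑ b ∈ (V \ a).powerset,
          (if P a then Z ((V \ a) \ b) b - Z ((V \ a) \ b) a - Z a ((V \ a) \ b) else 0) := by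
    rw [← Finset.sum_add_distrib]
    refine Finset.sum_congr rfl fun a _ => ?_
    rw [← Finset.sum_add_distrib]
    refine Finset.sum_congr rfl fun b _ => ?_
    split_ifs <;> ring
  rw [hsplit]
  linarith

/-- **Base case.**  On the empty ground set the constant `Q ≡ [P ∅]` is a certificate for every family `P`. [this work] -/
theorem cylinder_certificate_empty (P : Finset ι → Prop) [DecidablePred P] :
    (∀ S T : Finset ι, 0 ≤ (fun _ _ : Finset ι => if P ∅ then (1 : ℤ) else 0) S T) ∧
    (∀ Z : Finset ι → Finset ι → ℤ, (∀ S S' T, S ⊆ S' → Z S T ≤ Z S' T) → (∀ S T T', T ⊆ T' → Z S T ≤ Z S T') →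
      (∀ S S' T T', S ⊆ S' → T ⊆ T' → Z S' T + Z S T' ≤ Z S' T' + Z S T) →
      ∑ S ∈ (∅ : Finset ι).powerset, ∑ T ∈ (∅ : Finset ι).powerset, (fun _ _ : Finset ι => if P ∅ then (1 : ℤ) else 0) S T * Z S T ≤
        ∑ a ∈ (∅ : Finset ι).powerset, ∑ b ∈ (∅ \ a).powerset,
          (if P a then 2 * Z a a - Z ((∅ \ a) \ b) ((∅ \ a) \ b) else 0)) ∧
    (∀ Z : Finset ι → Finset ι → ℤ, (∀ S S' T, S ⊆ S' → Z S T ≤ Z S' T) → (∀ S T T', T ⊆ T' → Z S T ≤ Z S T') →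
      (∀ S S' T T', S ⊆ S' → T ⊆ T' → Z S' T + Z S T' ≤ Z S' T' + Z S T) →
      0 ≤ (∑ a ∈ (∅ : Finset ι).powerset, ∑ b ∈ (∅ \ a).powerset,
          (if P a then Z ((∅ \ a) \ b) b - Z ((∅ \ a) \ b) a - Z a ((∅ \ a) \ b) else 0)) +
        ∑ S ∈ (∅ : Finset ι).powerset, ∑ T ∈ (∅ : Finset ι).powerset,
          (fun _ _ : Finset ι => if P ∅ then (1 : ℤ) else 0) S T * Z S T) := by
  refine ⟨fun S T => by simp only; split_ifs <;> norm_num, fun Z _ _ _ => ?_, fun Z _ _ _ => ?_⟩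
  · simp only [Finset.powerset_empty, Finset.sum_singleton, Finset.empty_sdiff]
    split_ifs <;> linarith
  · simp only [Finset.powerset_empty, Finset.sum_singleton, Finset.empty_sdiff]
    split_ifs <;> linarith

/-! ## Iterating THEOREM F from the empty ground set: a certificate for ALL faces of every cube -/

/-- **All faces carry a certificate.**  Iterating `cylinder_certificate_insert` from `cylinder_certificate_empty` (family `P ≡ True`):
for every finite `V` there is `Q ≥ 0` splitting the full face sum of `2^V` as in property `R`. [this work] -/
theorem allFaces_certificate_exists (V : Finset ι) :
    ∃ Q : Finset ι → Finset ι → ℤ, (∀ S T, 0 ≤ Q S T) ∧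
    (∀ Z : Finset ι → Finset ι → ℤ, (∀ S S' T, S ⊆ S' → Z S T ≤ Z S' T) → (∀ S T T', T ⊆ T' → Z S T ≤ Z S T') →
      (∀ S S' T T', S ⊆ S' → T ⊆ T' → Z S' T + Z S T' ≤ Z S' T' + Z S T) →
      ∑ S ∈ V.powerset, ∑ T ∈ V.powerset, Q S T * Z S T ≤
        ∑ a ∈ V.powerset, ∑ b ∈ (V \ a).powerset,
          (if (fun _ : Finset ι => True) a then 2 * Z a a - Z ((V \ a) \ b) ((V \ a) \ b) else 0)) ∧
    (∀ Z : Finset ι → Finset ι → ℤ, (∀ S S' T, S ⊆ S' → Z S T ≤ Z S' T) → (∀ S T T', T ⊆ T' → Z S T ≤ Z S T') →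
      (∀ S S' T T', S ⊆ S' → T ⊆ T' → Z S' T + Z S T' ≤ Z S' T' + Z S T) →
      0 ≤ (∑ a ∈ V.powerset, ∑ b ∈ (V \ a).powerset,
          (if (fun _ : Finset ι => True) a then Z ((V \ a) \ b) b - Z ((V \ a) \ b) a - Z a ((V \ a) \ b) else 0)) +
        ∑ S ∈ V.powerset, ∑ T ∈ V.powerset, Q S T * Z S T) := by
  induction V using Finset.induction_on with
  | empty =>
    exact ⟨_, (cylinder_certificate_empty (fun _ : Finset ι => True)).1, (cylinder_certificate_empty (fun _ : Finset ι => True)).2.1,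
      (cylinder_certificate_empty (fun _ : Finset ι => True)).2.2⟩
  | insert e V he ih =>
    obtain ⟨Q, hQ, hD, hN⟩ := ih
    have hF := cylinder_certificate_insert he (fun _ : Finset ι => True) Q hQ hD hN
    refine ⟨fun S T => if e ∈ S then (if e ∈ T then Q (S.erase e) (T.erase e) else 0) else (if e ∈ T then 0 else 2 * Q S T),
      fun S T => ?_, hF.1, hF.2⟩
    show 0 ≤ (if e ∈ S then (if e ∈ T then Q (S.erase e) (T.erase e) else 0) else (if e ∈ T then 0 else 2 * Q S T))
    split_ifs
    · exact hQ _ _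
    · exact le_rfl
    · exact le_rfl
    · linarith [hQ S T]

/-- **Conjecture W on the full cube, all faces** (re-derivation of the case `x₀ = y₀ = ∅` of THEOREM P⊗ through certificates): for every
monotone 2-increasing weight `Z`, `Σ_{(a|b|c) face of 2^V} (2Z(a,a) + Z(c,b) − Z(c,a) − Z(a,c) − Z(c,c)) ≥ 0`. [this work] -/
theorem allFaces_kernelZ_sum_nonneg (V : Finset ι) (Z : Finset ι → Finset ι → ℤ)
    (hl : ∀ S S' T, S ⊆ S' → Z S T ≤ Z S' T) (hr : ∀ S T T', T ⊆ T' → Z S T ≤ Z S T')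
    (hm : ∀ S S' T T', S ⊆ S' → T ⊆ T' → Z S' T + Z S T' ≤ Z S' T' + Z S T) :
    0 ≤ ∑ a ∈ V.powerset, ∑ b ∈ (V \ a).powerset,
      (2 * Z a a + Z ((V \ a) \ b) b - Z ((V \ a) \ b) a - Z a ((V \ a) \ b) - Z ((V \ a) \ b) ((V \ a) \ b)) := by
  obtain ⟨Q, _, hD, hN⟩ := allFaces_certificate_exists V
  have h := cylinder_kernelZ_sum_nonneg_of_certificate V (fun _ : Finset ι => True) Q hD hN Z hl hr hm
  simp only [if_true] at h
  exact h

end Summit.CriticalPhenomena.PercolationContinuityZ3.Theorems.ThreePartition
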